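import Literature.Probability.RandomPlanarGeometry.HexSAWKestenRenewal

/-!
# Flat calibration of band-wise renewal (`BandRenewalC`, item stmt-CriticalPhenomena-18669): the necessity corollary

Strategist s4 on crux stmt-CriticalPhenomena-10472 (`SAWDevelopingMap.ObservableToSLE`).  In the flat half-plane, empty-past
toy model of the research stub R1 `stub_bandRenewal` (line `six_class_type_ladder` r17) the renewal heights of the critical
infinite bridge form a renewal set with renewal function `u_T = B_T(x_c) = HV.stripBlim T` (Kesten's relation
`HV.hasSum_stripIlim`, renewal equation `HV.renewal_equation`).  Renewal in a band `(T, θT]` with probability bounded below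
is equivalent (elementary renewal theory; Dynkin–Lamperti) to **band-mass** of `U(T) = Σ_{s ≤ T} B_s(x_c)`:
`U(θT) ≥ (1 + c)·U(T)` eventually.  This file proves the NECESSITY COROLLARY, def-free:

band-mass ⇒ `T · B_T(x_c)` is unbounded,

i.e. any proof of band-wise renewal that covers the flat case must improve the Duminil-Copin–Smirnov lower bound
`B_T ≥ m/T` (`HV.stripBlim_ge_div`) to `sup_T T·B_T(x_c) = +∞` (in print: only `m/T ≤ B_T ≤ 100·T^{-10^{-10}}`,
Krachun–Panagiotis arXiv:2310.17299 Thm 2).  Inputs: `tendsto_sum_stripBlim_atTop` (`U → ∞`) and `stripBlim_nonneg`.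
-/

noncomputable section

open scoped BigOperators
open Finset Filter
open Literature.Probability.RandomPlanarGeometry.SAW

namespace Summit.CriticalPhenomena.SAWScalingLimit.Theorems.ObservableToSLE.FlatCalibration

/-- Under the ceiling `T·B_T ≤ M` (`T ≥ 1`), the band increment of `U` is bounded:
`Σ_{T < s ≤ θT} B_s ≤ M (θ - 1)` for `T ≥ 1`, `θ ≥ 1`. -/
theorem band_increment_le {M : ℝ} (hM : ∀ T : ℕ, 1 ≤ T → (T : ℝ) * HV.stripBlim T ≤ M)
    {θ T : ℕ} (hθ : 1 ≤ θ) (hT : 1 ≤ T) :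
    ∑ s ∈ range (θ * T), HV.stripBlim (s + 1) - ∑ s ∈ range T, HV.stripBlim (s + 1) ≤ M * (θ - 1) := by
  rw [← sum_range_add_sum_Ico _ (Nat.le_mul_of_pos_left T hθ), add_sub_cancel_left]
  have hterm : ∀ s ∈ Ico T (θ * T), HV.stripBlim (s + 1) ≤ M / T := by
    intro s hs
    rw [mem_Ico] at hs
    have h1 := hM (s + 1) (by omega)
    have hTpos : (0 : ℝ) < T := by exact_mod_cast hT
    rw [le_div_iff₀ hTpos]
    have hB : 0 ≤ HV.stripBlim (s + 1) := stripBlim_nonneg (by omega)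
    calc HV.stripBlim (s + 1) * T ≤ HV.stripBlim (s + 1) * ((s + 1 : ℕ) : ℝ) :=
          mul_le_mul_of_nonneg_left (by exact_mod_cast (by omega : T ≤ s + 1)) hB
      _ = ((s + 1 : ℕ) : ℝ) * HV.stripBlim (s + 1) := by ring
      _ ≤ M := h1
  calc ∑ s ∈ Ico T (θ * T), HV.stripBlim (s + 1) ≤ ∑ _s ∈ Ico T (θ * T), M / T := sum_le_sum hterm
    _ = ((θ * T - T : ℕ) : ℝ) * (M / T) := by rw [sum_const, Nat.card_Ico, nsmul_eq_mul]
    _ = M * (θ - 1) := by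
        have hTne : (T : ℝ) ≠ 0 := by exact_mod_cast (by omega : T ≠ 0)
        rw [Nat.cast_sub (Nat.le_mul_of_pos_left T hθ), Nat.cast_mul]
        field_simp

/-- **Band-mass of the critical bridge sums forces `sup_T T·B_T(x_c) = ∞`.**  If for some integer ratio `θ ≥ 2` and
`c > 0` eventually `(1 + c)·Σ_{s ≤ T} B_s(x_c) ≤ Σ_{s ≤ θT} B_s(x_c)`, then there is no `M` with `T·B_T(x_c) ≤ M` for
all `T ≥ 1`.  (The flat floor of band-wise renewal lies strictly above the Duminil-Copin–Smirnov bound `B_T ≥ m/T`.)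
[cite: DuminilCopinSmirnov2012, §3; arXiv:2310.17299, Thm 2; Bertoin1999Subordinators, Thm 3.2 (Dynkin–Lamperti)] -/
theorem not_linearDecayCeiling_of_bridgeBandMass
    (h : ∃ θ : ℕ, 2 ≤ θ ∧ ∃ c : ℝ, 0 < c ∧ ∀ᶠ T : ℕ in atTop,
      (1 + c) * ∑ s ∈ range T, HV.stripBlim (s + 1) ≤ ∑ s ∈ range (θ * T), HV.stripBlim (s + 1)) :
    ¬ ∃ M : ℝ, ∀ T : ℕ, 1 ≤ T → (T : ℝ) * HV.stripBlim T ≤ M := by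
  rintro ⟨M, hM⟩
  obtain ⟨θ, hθ, c, hc, hev⟩ := h
  have hU : Tendsto (fun T : ℕ => ∑ s ∈ range T, HV.stripBlim (s + 1)) atTop atTop :=
    tendsto_sum_stripBlim_atTop
  have hbig : ∀ᶠ T : ℕ in atTop, M * (θ - 1) / c + 1 ≤ ∑ s ∈ range T, HV.stripBlim (s + 1) :=
    hU.eventually (eventually_ge_atTop _)
  obtain ⟨T, hT1, hbm, hb⟩ := ((eventually_ge_atTop 1).and (hev.and hbig)).exists
  have hinc := band_increment_le hM (by omega : 1 ≤ θ) hT1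
  have hcU : c * ∑ s ∈ range T, HV.stripBlim (s + 1) ≤ M * (θ - 1) := by nlinarith [hbm, hinc]
  have h2 : c * (M * (θ - 1) / c + 1) ≤ c * ∑ s ∈ range T, HV.stripBlim (s + 1) :=
    mul_le_mul_of_nonneg_left hb hc.le
  have hcne : c ≠ 0 := hc.ne'
  have h3 : M * (θ - 1) + c ≤ c * ∑ s ∈ range T, HV.stripBlim (s + 1) := by
    calc M * (θ - 1) + c = c * (M * (θ - 1) / c + 1) := by field_simp
      _ ≤ _ := h2
  linarith

end Summit.CriticalPhenomena.SAWScalingLimit.Theorems.ObservableToSLE.FlatCalibration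

end
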